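import Literature.MathematicalPhysics.QuantumFieldTheory.Balaban1983to89.B16Sect1Wilson

/-!
# `Balaban1983to89.B16Sect1Assembly` — T. Bałaban, *Large field renormalization. II. Localization, exponentiation,
and bounds for the 𝐑 operation*, Commun. Math. Phys. **122** (1989) 355–392 [Balaban1989LargeFieldII], Sect. 1
pp. 356–357 and 369: the ASSEMBLY DISPLAYS (1.1) (the result of the 𝐑′-operation on one term of (1.99) [IV]), (1.2)
(the denominator after the chart `V′ = exp ig_kB′` and (2.8) [I]) and (1.49) (*"(1.1) = …"*, the same expression after
all the Wilson-term transformations (1.2)–(1.48)) — typed as real numbers built from Bochner integrals over EXPLICIT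
measure spaces, with **(1.49) PROVED** as the bookkeeping identity the text announces: (1.1) × (1.10) with (1.37) and
(1.48) inserted, the constant `𝐂_k` DEFINED as printed (*"the sum of all these terms, including the term I(U₀) from the
denominator"*), and the link (1.2) ↔ (1.10) PROVED (`eq12_exp_neg_I110`)

statement-level skeleton of published theorems with citation tags; proofs where landed; nothing here is a claim about
the Yang–Mills mass gap

PDF held: `paper:balaban1989-cmp122-large-field-ii` (journal page = PDF page + 354); [I] = [Balaban1987RG1], [IV] =
[Balaban1989LargeFieldI].  The quotations below were READ AS AN IMAGE by this seat on the x2 renders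
`run/shared/lean/pub/pub-balaban/b2b-balaban-ref1/pages/1989-cmp122-large-field-II/…-p002,p003,p015-x2.png` (pp. 356,
357, 369).

CITATION HEADER / WHAT IS REPRODUCED (mega-formalization `lit-balaban`, reader/typer r13 gen 4; HOME
`run/shared/lean/pub/lit-balaban/`, rows `lit-balaban-r13/ROWS-B16.md` v2.5): SKELETON rows **B16.Eq1.1, B16.Eq1.2,
B16.Eq1.49** (all `absent` at SKELETON v3.18: "assembly displays — functional integrals").

CARRIERS (ref-1 F6, explicit; nothing assumed about them).  The integrations of (1.1) are Bochner integrals against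
explicit measures: `μV` on a space `ΩV` of the variables `V′↾_Λ` = the measure `dV′↾_Λ δ_{G₀}(V′)χ` (Haar measure on the
bond variables of `Λ` off the axial-gauge tree `G₀`, the characteristic function `χ` folded in); `μN` on `ΩN` = `dV′↾_{𝐁₀}
δ_{T₀}(V′)χ′` of the numerator; `μB` on `ΩB` = `dB′↾_Λ δ_{G₀}(B′)` (Lebesgue measure of the chart `V′ = exp ig_kB′`,
p. 356) and `μNB` on `ΩNB` = `dB δ_{T₀}(B)` (the chart of the numerator, p. 369).  The Wilson terms, the effective action
`A″_k` and its pieces are real-valued FUNCTIONS on these spaces, the characteristic-function prefactors are real FACTORS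
— exactly the letters of the displays; the configuration-level objects behind them (`U_{k,Z}(V′_kV_Λ)`, `U″_k`, `U_k`,
`U″_{h+2}(exp ig_kB, V″)`, …) are the `Sect1Data` configurations of `…B16Sect1Backgrounds`/`…B16Sect1WilsonTerms`, where
(1.37) and (1.48) are proved at the functional level; here they enter as the pointwise-in-`B` hypothesis `h3748`.
No `sorry`, no axiom; nothing printed is asserted as a fact.
-/

open MeasureTheory

namespace Literature.MathematicalPhysics.QuantumFieldTheory.Balaban1983to89.B16Sect1Assembly

open B16Sect1Wilson

noncomputable section

variable {ΩV ΩN ΩB ΩNB : Type*} [MeasurableSpace ΩV] [MeasurableSpace ΩN] [MeasurableSpace ΩB]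
  [MeasurableSpace ΩNB]

/-! ## (1.1): the result of the 𝐑′-operation on one term of (1.99) [IV] -/

/-- The DENOMINATOR of (1.1) p. 356, verbatim: *"∫dV′↾_Λ δ_{G₀}(V′)χ exp[−(1/g_k²)A(ζ₀, U_{k,Z}(V′V_Λ))]"* — the integral of
`exp(−g_k⁻²·AV)` against `μV = dV′↾_Λ δ_{G₀}(V′)χ`, `AV V′ = A(ζ₀, U_{k,Z}(V′V_Λ))`. [cite: Balaban1989LargeFieldII, (1.1) p.356] -/
def den11 (gk : ℝ) (μV : Measure ΩV) (AV : ΩV → ℝ) : ℝ := ∫ v, Real.exp (-(1 / gk ^ 2) * AV v) ∂μV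

/-- The NUMERATOR integral of (1.1) p. 356, verbatim: *"χ_{h,1/2}∫dV′↾_{𝐁₀} δ_{T₀}(V′)χ′ exp A″_k"* (without the factor
`χ_{h,1/2}`): `App V′ = A″_k`, the effective action of (1.99) [IV] as a function of `V′↾_{𝐁₀}`, against `μN = dV′↾_{𝐁₀}
δ_{T₀}(V′)χ′`. [cite: Balaban1989LargeFieldII, (1.1) p.356] -/
def num11 (μN : Measure ΩN) (App : ΩN → ℝ) : ℝ := ∫ v, Real.exp (App v) ∂μN

/-- **(1.1)** p. 356 [PDF 2], verbatim: *"The result of the 𝐑′-operation on the obtained expression can be written in the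
form χ_kχ_{k,Λ}δ_{G₀}(V′_k)χ exp[−(1/g_k²)A(ζ₀, U_{k,Z}(V′_kV_Λ))] · χ_{h,1/2}∫dV′↾_{𝐁₀}δ_{T₀}(V′)χ′ exp A″_k /
∫dV′↾_Λ δ_{G₀}(V′)χ exp[−(1/g_k²)A(ζ₀, U_{k,Z}(V′V_Λ))], (1.1) where we have omitted also the averagings over the choices of
G₀, T₀."* — the expression as a real number: `pref` = the prefactor `χ_kχ_{k,Λ}δ_{G₀}(V′_k)χ` (a density factor in the
variables kept), `χh = χ_{h,1/2}`, `A1 = A(ζ₀, U_{k,Z}(V′_kV_Λ))` (the configuration `Sect1Data.cfgKZ11` of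
`…B16Sect1WilsonTerms`), numerator `num11`, denominator `den11`. [cite: Balaban1989LargeFieldII, (1.1) p.356] -/
def term11 (pref χh gk A1 : ℝ) (μV : Measure ΩV) (AV : ΩV → ℝ) (μN : Measure ΩN) (App : ΩN → ℝ) : ℝ :=
  pref * Real.exp (-(1 / gk ^ 2) * A1) * (χh * num11 μN App) / den11 gk μV AV

/-! ## (1.2): the denominator in the chart `V′ = exp ig_kB′` -/

/-- The `B′`-integral of (1.2) pp. 356–357, verbatim: *"∫dB′↾_Λ σ(g_kB′)δ_{G₀}(B′)χ({|B′| < M₀g_k⁻¹ε_k}) · exp[−½⟨H_{1,k}B′,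
Δ₁(ζ₀)H_{1,k}B′⟩ − (1/g_k)⟨DH_{1,k}B′, ζ₀η⁻² Im ∂U₀⟩ − (1/g_k²)V(ζ₀, g_kH_{1,k}B′)]"* — against `μB = dB′↾_Λ δ_{G₀}(B′)` with
the weight `wB B′ = σ(g_kB′)χ({|B′| < M₀g_k⁻¹ε_k})` and the three exponent functions `Q B′ = ⟨H_{1,k}B′, Δ₁(ζ₀)H_{1,k}B′⟩`,
`L B′ = ⟨DH_{1,k}B′, ζ₀η⁻²Im ∂U₀⟩`, `V B′ = V(ζ₀, g_kH_{1,k}B′)`. [cite: Balaban1989LargeFieldII, (1.2) p.357] -/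
def int12 (gk : ℝ) (μB : Measure ΩB) (wB Q L V : ΩB → ℝ) : ℝ :=
  ∫ b, wB b * Real.exp (-(1 / 2) * Q b - 1 / gk * L b - 1 / gk ^ 2 * V b) ∂μB

/-- **(1.2)** pp. 356–357 [PDF 2–3], verbatim: *"Writing V′ = exp ig_kB′, identifying Λ with one of its components, and
using (2.8) [I], we get ∫dV′↾_Λ δ_{G₀}(V′)χ exp[−(1/g_k²)A(ζ₀, U_{k,Z}(V′V_Λ))] = exp[−(1/g_k²)A(ζ₀, U₀) + (−½d(g) log g_k⁻²
+ log σ₀)|Λ^{(k)}∖G₀|] · ∫dB′↾_Λ σ(g_kB′)δ_{G₀}(B′)χ({|B′| < M₀g_k⁻¹ε_k}) · exp[−½⟨H_{1,k}B′, Δ₁(ζ₀)H_{1,k}B′⟩ − (1/g_k)⟨DH_{1,k}B′,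
ζ₀η⁻² Im ∂U₀⟩ − (1/g_k²)V(ζ₀, g_kH_{1,k}B′)]. (1.2)"* — as a `Prop`; `A00 = A(ζ₀, U₀)`, and the constant
`(−½d(g) log g_k⁻² + log σ₀)|Λ^{(k)}∖G₀|` IS `E_k(Λ)` of (1.10) (`B16Sect1Wilson.Ek110 dg gk σ₀ n`, `n = |Λ^{(k)}∖G₀|`).
Its content (the Haar-chart change of variables of [I] (2.8) ff. and the criticality (1.4)–(1.5) of `U₀`) is not
asserted. [cite: Balaban1989LargeFieldII, (1.2) p.357] -/
def Eq12 (gk A00 dg σ₀ : ℝ) (n : ℕ) (μV : Measure ΩV) (AV : ΩV → ℝ) (μB : Measure ΩB)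
    (wB Q L V : ΩB → ℝ) : Prop :=
  den11 gk μV AV = Real.exp (-(1 / gk ^ 2) * A00 + Ek110 dg gk σ₀ n) * int12 gk μB wB Q L V

/-- (1.2) and (1.10) together, PROVED: if (1.2) holds and the denominator is positive, its `B′`-integral is `exp(−I(U₀))`
for the number `I(U₀)` DEFINED by (1.10) (`B16Sect1Wilson.I110`, with `E = E_k(Λ) = Ek110 …`) — i.e. (1.10)
*"(∫dV′↾_Λ …)⁻¹ = exp[+(1/g_k²)A(ζ₀, U₀) + I(U₀) − E_k(Λ)]"* is (1.2) read backwards. [cite: Balaban1989LargeFieldII, (1.10) p.358] -/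
theorem eq12_exp_neg_I110 {gk A00 dg σ₀ : ℝ} {n : ℕ} {μV : Measure ΩV} {AV : ΩV → ℝ} {μB : Measure ΩB}
    {wB Q L V : ΩB → ℝ} (h12 : Eq12 gk A00 dg σ₀ n μV AV μB wB Q L V) (hpos : 0 < den11 gk μV AV) :
    int12 gk μB wB Q L V = Real.exp (-I110 gk A00 (Ek110 dg gk σ₀ n) (den11 gk μV AV)) := by
  unfold Eq12 at h12
  have hexp : Real.exp (-I110 gk A00 (Ek110 dg gk σ₀ n) (den11 gk μV AV)) =
      den11 gk μV AV * Real.exp (1 / gk ^ 2 * A00 - Ek110 dg gk σ₀ n) := by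
    unfold I110
    rw [show -(-Real.log (den11 gk μV AV) - 1 / gk ^ 2 * A00 + Ek110 dg gk σ₀ n) =
        Real.log (den11 gk μV AV) + (1 / gk ^ 2 * A00 - Ek110 dg gk σ₀ n) by ring,
      Real.exp_add, Real.exp_log hpos]
  rw [hexp, h12, mul_assoc, mul_comm (int12 gk μB wB Q L V), ← mul_assoc, ← Real.exp_add,
    show -(1 / gk ^ 2) * A00 + Ek110 dg gk σ₀ n + (1 / gk ^ 2 * A00 - Ek110 dg gk σ₀ n) = 0 by ring,
    Real.exp_zero, one_mul]

/-! ## (1.49): `(1.1) = …` after the Wilson-term transformations -/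

/-- The constant **𝐂_k** inside (1.49), p. 369, verbatim: *"They have, however, two important common features: they are
all small, in fact their sum is also small, although we need boundedness only, and they depend on background fields
restricted to a neighborhood of the region Z, therefore they are boundary terms … We denote the sum of all these terms,
including the term I(U₀) from the denominator, by 𝐂_k."* — `I + small B` (`I = I(U₀)` of (1.10), `small` = the sum of
the `O(1)` terms of (1.37), (1.48) and the declared-small second term of (1.37), as a function of the integration
variable `B`); the abstract-family version with its bound is row B16.Def@369 (`B16Sect1Statements.Ck369`).
[cite: Balaban1989LargeFieldII, (1.49) p.369] -/
def Ck149 (I : ℝ) (small : ΩNB → ℝ) : ΩNB → ℝ := fun b => I + small b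

/-- The BRACKET of the second exponential of (1.49) p. 369: `−½⟨DH″_{1,k,Z}B, ζDH″_{1,k,Z}B⟩ − A((1/(g″_k(·))²)ζ₁, U″_{h+2}(exp
ig_kB, V″)) + 𝐂_k + 𝐄_k(U″_k) + 𝐑_k(U″_k) + 𝐁_k(U″_k, A) + 𝐁″_k(U″_k, A) − E_k + (−½d(𝐠) log g_k⁻² + log σ₀)|𝐁₀∖T₀| − E_k(Λ)`,
every term a function of the integration variable `B` (`Q121` = the form (1.21), `Ah2` = the positive Wilson term of
(1.48), `Ek`, `Rk`, `Bk`, `Bppk` = the inductive pieces of `A″_k` at `U″_k = U″_k(B)`), `Ekc = E_k`, `nBT = |𝐁₀∖T₀|`,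
`EkΛ = E_k(Λ)`. [cite: Balaban1989LargeFieldII, (1.49) p.369] -/
def bracket149 (gk dg σ₀ : ℝ) (nBT : ℕ) (Ekc EkΛ : ℝ) (Q121 Ah2 Ck Ek Rk Bk Bppk : ΩNB → ℝ) : ΩNB → ℝ :=
  fun b => -(1 / 2) * Q121 b - Ah2 b + Ck b + Ek b + Rk b + Bk b + Bppk b - Ekc + Ek110 dg gk σ₀ nBT - EkΛ

/-- **(1.49)** p. 369 [PDF 15], verbatim: *"As the result of all the transformations above we obtain the following
equality: (1.1) = χ_kχ_{k,Λ}δ_{G₀}(V′_k)χ exp[−A(1/(g_k(·))², U_k)] · χ_{h,1/2}∫dB σ(g_kB)δ_{T₀}(B)χ′ exp[−½⟨DH″_{1,k,Z}B,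
ζDH″_{1,k,Z}B⟩ − A((1/(g″_k(·))²)ζ₁, U″_{h+2}(exp ig_kB, V″)) + 𝐂_k + 𝐄_k(U″_k) + 𝐑_k(U″_k) + 𝐁_k(U″_k, A) + 𝐁″_k(U″_k, A) − E_k
+ (−½d(𝐠) log g_k⁻² + log σ₀)|𝐁₀∖T₀| − E_k(Λ)]. (1.49)"* — the right-hand side as a real number: `AcUk = A(1/(g_k(·))², U_k)`,
`wN b = σ(g_kB)χ′` against `μNB = dB δ_{T₀}(B)`. [cite: Balaban1989LargeFieldII, (1.49) p.369] -/
def rhs149 (pref χh AcUk : ℝ) (μNB : Measure ΩNB) (wN bracket : ΩNB → ℝ) : ℝ :=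
  pref * Real.exp (-AcUk) * (χh * ∫ b, wN b * Real.exp (bracket b) ∂μNB)

/-- **(1.49) PROVED as the bookkeeping the text describes** (*"As the result of all the transformations above we obtain
the following equality"*): from
* `hpos` — the denominator of (1.1) is positive, so that (1.10) applies with `I(U₀) := I110 …` (`B16Sect1Wilson.eq110`);
* `hcov` — the chart `V′ = exp ig_kB` in the NUMERATOR integral: *"∫dV′↾_{𝐁₀}δ_{T₀}(V′)χ′ exp A″_k = exp[(−½d(𝐠) log g_k⁻² +
  log σ₀)|𝐁₀∖T₀|] ∫dB σ(g_kB)δ_{T₀}(B)χ′ exp A″_k"* (the Haar-chart normalisation of [I] (2.8) ff., as used in (1.2); a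
  hypothesis);
* `hApp` — the form of the effective action of (1.99) [IV] in the variable `B`: `A″_k = −A(1/(g″_k(·))², U″_k) + 𝐄_k(U″_k) +
  𝐑_k(U″_k) + 𝐁_k(U″_k, A) + 𝐁″_k(U″_k, A) − E_k` (`AppW b` = its Wilson term);
* `h3748` — (1.37) followed by (1.48), pointwise in `B`: `−g_k⁻²A(ζ₀, U_{k,Z}(V′_kV_Λ)) − A(1/(g″_k(·))², U″_k) + g_k⁻²A(ζ₀, U₀)
  = −A(1/(g_k(·))², U_k) − ½(1.21) − A((1/(g″_k(·))²)ζ₁, U″_{h+2}(exp ig_kB, V″)) + small` (`small` = the `O(1)`'s of (1.37),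
  (1.48) and the declared-small second term of (1.37); proved at the functional level as
  `B16Sect1WilsonTerms.eq137_chain`/`eq148_of_repr146`),
the expression (1.1) EQUALS the right-hand side of (1.49) with `𝐂_k = I(U₀) + small` (`Ck149`).  The proof is (1.1) ×
(1.10), the cancellation of `±g_k⁻²A(ζ₀, U₀)`, and pulling the `B`-independent factor `exp[−A(1/(g_k(·))², U_k)]` out of the
integral. [cite: Balaban1989LargeFieldII, (1.49) p.369] -/
theorem eq149 {pref χh gk A1 A00 AcUk dg σ₀ Ekc : ℝ} {nBT nΛ : ℕ} {μV : Measure ΩV} {AV : ΩV → ℝ}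
    {μN : Measure ΩN} {App : ΩN → ℝ} {μNB : Measure ΩNB}
    {wN AppB AppW Q121 Ah2 Ek Rk Bk Bppk small : ΩNB → ℝ} (hpos : 0 < den11 gk μV AV)
    (hcov : num11 μN App = Real.exp (Ek110 dg gk σ₀ nBT) * ∫ b, wN b * Real.exp (AppB b) ∂μNB)
    (hApp : ∀ b, AppB b = -AppW b + Ek b + Rk b + Bk b + Bppk b - Ekc)
    (h3748 : ∀ b, -(1 / gk ^ 2) * A1 - AppW b + 1 / gk ^ 2 * A00 =
      -AcUk - 1 / 2 * Q121 b - Ah2 b + small b) :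
    term11 pref χh gk A1 μV AV μN App =
      rhs149 pref χh AcUk μNB wN
        (bracket149 gk dg σ₀ nBT Ekc (Ek110 dg gk σ₀ nΛ) Q121 Ah2
          (Ck149 (I110 gk A00 (Ek110 dg gk σ₀ nΛ) (den11 gk μV AV)) small) Ek Rk Bk Bppk) := by
  -- abbreviations
  set D := den11 gk μV AV with hD
  set EΛ := Ek110 dg gk σ₀ nΛ with hEΛ
  set I := I110 gk A00 EΛ D with hI
  -- (1.10): `D⁻¹ = exp(g⁻²A00 + I − EΛ)`
  have h110 : D⁻¹ = Real.exp (1 / gk ^ 2 * A00 + I - EΛ) := eq110 gk A00 EΛ D hpos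
  -- the pointwise exponent identity
  have key : ∀ b, -(1 / gk ^ 2) * A1 + (1 / gk ^ 2 * A00 + I - EΛ) + Ek110 dg gk σ₀ nBT + AppB b =
      -AcUk + bracket149 gk dg σ₀ nBT Ekc EΛ Q121 Ah2 (Ck149 I small) Ek Rk Bk Bppk b := by
    intro b
    simp only [bracket149, Ck149, hApp b]
    linear_combination h3748 b
  -- rewrite (1.1)
  unfold term11 rhs149
  rw [div_eq_mul_inv, ← hD, h110, hcov]
  -- collect the constant exponentials into the integrand
  have hconst : pref * Real.exp (-(1 / gk ^ 2) * A1) *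
        (χh * (Real.exp (Ek110 dg gk σ₀ nBT) * ∫ b, wN b * Real.exp (AppB b) ∂μNB)) *
        Real.exp (1 / gk ^ 2 * A00 + I - EΛ) =
      pref * (χh * ((Real.exp (-(1 / gk ^ 2) * A1) * Real.exp (1 / gk ^ 2 * A00 + I - EΛ) *
        Real.exp (Ek110 dg gk σ₀ nBT)) * ∫ b, wN b * Real.exp (AppB b) ∂μNB)) := by ring
  rw [hconst, ← integral_const_mul]
  have hint : (fun b => Real.exp (-(1 / gk ^ 2) * A1) * Real.exp (1 / gk ^ 2 * A00 + I - EΛ) *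
        Real.exp (Ek110 dg gk σ₀ nBT) * (wN b * Real.exp (AppB b))) =
      fun b => Real.exp (-AcUk) *
        (wN b * Real.exp (bracket149 gk dg σ₀ nBT Ekc EΛ Q121 Ah2 (Ck149 I small) Ek Rk Bk Bppk b)) := by
    funext b
    have h := congrArg Real.exp (key b)
    rw [Real.exp_add, Real.exp_add, Real.exp_add, Real.exp_add] at h
    calc _ = wN b * (Real.exp (-(1 / gk ^ 2) * A1) * Real.exp (1 / gk ^ 2 * A00 + I - EΛ) *
          Real.exp (Ek110 dg gk σ₀ nBT) * Real.exp (AppB b)) := by ring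
      _ = wN b * (Real.exp (-AcUk) *
          Real.exp (bracket149 gk dg σ₀ nBT Ekc EΛ Q121 Ah2 (Ck149 I small) Ek Rk Bk Bppk b)) := by rw [h]
      _ = _ := by ring
  rw [hint, integral_const_mul]
  ring

end

end Literature.MathematicalPhysics.QuantumFieldTheory.Balaban1983to89.B16Sect1Assembly
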